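import Mathlib
import Summits.NavierStokesRegularity.NavierStokesRegularity.Theorems.EulerZoomLiouvillePowerGaugeEulerLiouvilleSelfSimilarBernoulliPiercing
import Summits.NavierStokesRegularity.NavierStokesRegularity.Theorems.EulerZoomLiouvillePowerGaugeEulerLiouvilleSelfSimilarKelvinFlowC2
import Literature.Analysis.ODE.LiouvilleFormula
import HarnessLib.Audit

/-!
# Crux `EulerZoomLiouville.PowerGaugeEulerLiouville` (stmt-NavierStokesRegularity-19832), THE ONE STATEMENT `stub_selfSimilarC2Needle`:
# the BERNOULLI LANDSCAPE of a `C²` self-similar Euler profile — volume growth `e^{3γs}` of the similarity flow and the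
# MINIMUM PRINCIPLE: `ℋ` restricted to any closed ball attains its minimum on the boundary sphere

Route №10 `EulerZoomLiouville` (NavierStokesRegularity), crux E = stmt-NavierStokesRegularity-19832; LEAD ns-typeII-p2 g11, item (C1) of RESIDUE-MEMO-19832-g11 §2
(«Bernoulli-channel calculus»).  Sequel of `…SelfSimilarBernoulliPiercing` (p624179: `ℋ = ½|W|² + P + ½γ(γ−1)|y|²`, `W = γy + U`, is non-decreasing along BACKWARD
similarity orbits, `W·∇ℋ = −(1−2γ)|W|²`, CIV (3.31)).  Two facts every further lever on the needle uses:

* TOOL (`C²` twin of the `C^∞` `Kelvin.det_fderiv_flow` / `Kelvin.volume_image_flow`, LOCALISED): for a `C²` field `Ṽ` with bounded gradient that is divergence-free on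
  the closed ball `‖z‖ ≤ R`, the flow `Φ` of `W̃ = γy + Ṽ` has Jacobian `det DΦ_T(y) = e^{3γT}` at every `y` whose orbit stays in that ball on `[0,T]`
  (`det_fderiv_flow_eq_exp_of_stay`: the `C²` variational equation `C2.Kelvin.hasDerivAt_fderiv_flow` + the Abel–Liouville–Jacobi formula
  `Literature.Analysis.ODE.det_eq_exp_mul_of_trace_eq`, trace `3γ + div Ṽ = 3γ`), hence `vol(Φ_T A) = e^{3γT}·vol A` for measurable `A` all of whose orbits stay
  (`volume_image_flow_eq_exp_of_stay`, area formula `lintegral_abs_det_fderiv_eq_addHaar_image`).  The self-similar flow EXPANDS volume: no bounded set of positive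
  finite measure is forward-invariant.
* MINIMUM PRINCIPLE (`Loc.exists_sphere_selfSimilarBernoulli_le`): for a `C²` profile of CIV (3.3) with `0 < γ ≤ ½`, every centre `z`, radius `δ > 0` and point `x` of
  the closed ball `‖x − z‖ ≤ δ`, SOME point `y` of the sphere `‖y − z‖ = δ` has `ℋ(y) ≤ ℋ(x)`.  Proof: otherwise `m := min_{sphere} ℋ > ℋ(x)` and the open set
  `U := ball(z,δ) ∩ {ℋ < m} ∋ x` is FORWARD-invariant (along forward orbits `ℋ` is non-increasing, so an orbit from `U` cannot reach the sphere, where `ℋ ≥ m`), bounded,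
  of positive finite measure — contradicting `vol(Φ_1 U) = e^{3γ}·vol U > vol U`.  COROLLARIES: `ℋ` has NO STRICT LOCAL MINIMUM (`Loc.not_strictLocalMin_selfSimilarBernoulli`);
  on the irrotational set this is the superharmonicity `Δℋ = −3γ(1−2γ) < 0`, here obtained with vorticity and without second derivatives.  (Local MAXIMA: Literature
  `SelfSimilarEulerBernoulliLocalMax` — only at non-vortical stagnation points with `DW ≥ 0`.)

Reading for the needle (RESIDUE-MEMO-19832-g11 §0–§2): the landscape of a needle profile has `min_{B̄_R} ℋ = min_{S_R} ℋ ≈ −½γ(1−2γ)R²` (bulk) while every large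
sphere also carries a vortical fast-inflow point with `ℋ ≥ h` (v48 binder); no pocket of locally minimal `ℋ` can sit anywhere — every sublevel region drains to infinity.

WHAT THIS IS NOT: not NS, not E — a tool and a portrait for THE ONE STATEMENT; no stratum is closed here; 19832 is OPEN.
[folklore; ConstantinIgnatovaVicol2026Putative §3.4.1 (3.21)–(3.22), §3.4.3 (3.30)–(3.33); Hartman, *ODE*, Ch. IV Thm 1.2 (Liouville's formula)]
-/

noncomputable section

set_option linter.dupNamespace false

open MeasureTheory Set Filter Topology Metric Function InnerProductSpace
open scoped RealInnerProductSpace NNReal ENNReal ContDiff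

namespace Summit.NavierStokesRegularity.NavierStokesRegularity.Theorems.PowerGaugeEulerLiouville.BernoulliLandscape

open Literature.Analysis Literature.Analysis.FluidPDE
open Summit.NavierStokesRegularity.NavierStokesRegularity.Theorems.PowerGaugeEulerLiouville.Kelvin

variable {γ : ℝ} {V : EuclideanSpace ℝ (Fin 3) → EuclideanSpace ℝ (Fin 3)}

/-! ### The localised Jacobian and volume formulas for the similarity flow of a `C²` field -/

/-- **`det DΦ_T(y) = e^{3γT}` along an orbit that stays where the field is divergence-free.**  `Ṽ ∈ C²` with `‖DṼ‖ ≤ K`, divergence-free on the closed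
ball `‖z‖ ≤ R`; `Φ` the flow of `γy + Ṽ`; `T ≥ 0`; `‖Φ_σ y‖ ≤ R` for `σ ∈ [0,T]`.  (Variational equation + Liouville's formula with constant trace `3γ`.)
[cite: ConstantinIgnatovaVicol2026Putative, §3.4.1 eq. (3.22) (remark after)] -/
theorem det_fderiv_flow_eq_exp_of_stay (hV : ContDiff ℝ 2 V) {K : ℝ} (hK : ∀ y, ‖fderiv ℝ V y‖ ≤ K)
    {R T : ℝ} (hT : 0 ≤ T) (hdiv : ∀ z : EuclideanSpace ℝ (Fin 3), ‖z‖ ≤ R → VectorCalculus.divergence V z = 0)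
    (y : EuclideanSpace ℝ (Fin 3))
    (hstay : ∀ σ ∈ Icc 0 T, ‖ODE.evolutionMap (fun _ : ℝ => selfSimilarTransport γ 0 V) 0 σ y‖ ≤ R) :
    (fderiv ℝ (ODE.evolutionMap (fun _ : ℝ => selfSimilarTransport γ 0 V) 0 T) y).det = Real.exp (3 * γ * T) := by
  set Φ := ODE.evolutionMap (fun _ : ℝ => selfSimilarTransport γ 0 V) 0 with hΦ
  have hV1 : ContDiff ℝ 1 V := hV.of_le (by norm_num)
  set J : ℝ → EuclideanSpace ℝ (Fin 3) →L[ℝ] EuclideanSpace ℝ (Fin 3) := fun s => fderiv ℝ (Φ s) y with hJ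
  set A : ℝ → EuclideanSpace ℝ (Fin 3) →L[ℝ] EuclideanSpace ℝ (Fin 3) :=
    fun s => γ • ContinuousLinearMap.id ℝ (EuclideanSpace ℝ (Fin 3)) + fderiv ℝ V (Φ s y) with hA
  have hJ' : ∀ s, HasDerivAt J ((A s).comp (J s)) s := fun s =>
    C2.Kelvin.hasDerivAt_fderiv_flow (γ := γ) hV hK s y
  -- continuity of `A` (the orbit is continuous, `DV` is continuous)
  have hAc : Continuous A := by
    have h1 : Continuous fun s => fderiv ℝ V (Φ s y) :=
      (hV.continuous_fderiv (by norm_num)).comp (C2.Kelvin.continuous_flow_apply (γ := γ) hV1 hK y)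
    exact continuous_const.add h1
  have hJc : ∀ v, ContinuousOn (fun s => J s v) (Icc 0 T) := fun v =>
    (continuous_iff_continuousAt.2 fun s => ((hJ' s).continuousAt.clm_apply continuousAt_const)).continuousOn
  have hJ'v : ∀ v, ∀ t ∈ Ico 0 T, HasDerivWithinAt (fun u => J u v) (A t (J t v)) (Ici t) t := by
    intro v t _
    have h := (hJ' t).clm_apply (hasDerivAt_const t v)
    simp only [ContinuousLinearMap.comp_apply, map_zero, add_zero] at h
    exact h.hasDerivWithinAt
  have hJ0 : J 0 = ContinuousLinearMap.id ℝ (EuclideanSpace ℝ (Fin 3)) := by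
    have h0 : Φ 0 = id := by
      funext x
      exact ODE.evolutionMap_self _ 0 x
    simp only [hJ, h0]
    exact fderiv_id
  have hd : ∀ s ∈ Icc 0 T, LinearMap.trace ℝ (EuclideanSpace ℝ (Fin 3)) (A s : EuclideanSpace ℝ (Fin 3) →ₗ[ℝ] EuclideanSpace ℝ (Fin 3)) = 3 * γ := by
    intro s hs
    have h1 : LinearMap.trace ℝ (EuclideanSpace ℝ (Fin 3))
        ((fderiv ℝ V (Φ s y) : EuclideanSpace ℝ (Fin 3) →L[ℝ] EuclideanSpace ℝ (Fin 3)) :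
          EuclideanSpace ℝ (Fin 3) →ₗ[ℝ] EuclideanSpace ℝ (Fin 3)) = 0 := by
      have := hdiv (Φ s y) (hstay s hs)
      simpa [VectorCalculus.divergence] using this
    simp only [hA, ContinuousLinearMap.toLinearMap_add, ContinuousLinearMap.toLinearMap_smul, map_add, map_smul, h1, add_zero,
      ContinuousLinearMap.coe_id, LinearMap.trace_id, smul_eq_mul]
    simp [finrank_euclideanSpace]
    ring
  have h := Literature.Analysis.ODE.det_eq_exp_mul_of_trace_eq hT hAc.continuousOn hJc hJ'v hJ0 hd T
    ⟨hT, le_rfl⟩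
  simpa [hJ] using h

/-- **`vol(Φ_T A) = e^{3γT}·vol A`** for a measurable set `A` all of whose orbits stay, on `[0,T]`, in the closed ball `‖z‖ ≤ R` where `Ṽ ∈ C²` (`‖DṼ‖ ≤ K`) is
divergence-free. (Area formula with the constant Jacobian of `det_fderiv_flow_eq_exp_of_stay`; the flow is injective.)
[cite: ConstantinIgnatovaVicol2026Putative, §3.4.1 eq. (3.22) (remark after)] -/
theorem volume_image_flow_eq_exp_of_stay (hV : ContDiff ℝ 2 V) {K : ℝ} (hK : ∀ y, ‖fderiv ℝ V y‖ ≤ K)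
    {R T : ℝ} (hT : 0 ≤ T) (hdiv : ∀ z : EuclideanSpace ℝ (Fin 3), ‖z‖ ≤ R → VectorCalculus.divergence V z = 0)
    {A : Set (EuclideanSpace ℝ (Fin 3))} (hAm : MeasurableSet A)
    (hstay : ∀ y ∈ A, ∀ σ ∈ Icc 0 T, ‖ODE.evolutionMap (fun _ : ℝ => selfSimilarTransport γ 0 V) 0 σ y‖ ≤ R) :
    volume (ODE.evolutionMap (fun _ : ℝ => selfSimilarTransport γ 0 V) 0 T '' A) =
      ENNReal.ofReal (Real.exp (3 * γ * T)) * volume A := by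
  set Φ := ODE.evolutionMap (fun _ : ℝ => selfSimilarTransport γ 0 V) 0 with hΦ
  have hV1 : ContDiff ℝ 1 V := hV.of_le (by norm_num)
  have hL := C2.Kelvin.isUniformlyLipschitzOn_transport (γ := γ) hV1 hK
  have hdiff : ∀ x ∈ A, HasFDerivWithinAt (Φ T) (fderiv ℝ (Φ T) x) A x := fun x _ =>
    (((C2.Kelvin.contDiff_flow (γ := γ) hV hK T).differentiable (by norm_num)) x).hasFDerivAt.hasFDerivWithinAt
  have hinj : InjOn (Φ T) A := (hL.bijective_evolutionMap convex_univ (mem_univ _) (mem_univ _)).injective.injOn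
  rw [← lintegral_abs_det_fderiv_eq_addHaar_image volume hAm hdiff hinj]
  have hdet : EqOn (fun x => ENNReal.ofReal |(fderiv ℝ (Φ T) x).det|) (fun _ => ENNReal.ofReal (Real.exp (3 * γ * T))) A := by
    intro x hx
    simp only
    rw [det_fderiv_flow_eq_exp_of_stay (γ := γ) hV hK hT hdiv x (hstay x hx), abs_of_pos (Real.exp_pos _)]
  rw [setLIntegral_congr_fun hAm hdet, setLIntegral_const]

end Summit.NavierStokesRegularity.NavierStokesRegularity.Theorems.PowerGaugeEulerLiouville.BernoulliLandscape

/-! ### The minimum principle for the Bernoulli function -/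

namespace Summit.NavierStokesRegularity.NavierStokesRegularity.Theorems.PowerGaugeEulerLiouville.Loc

open Literature.Analysis Literature.Analysis.FluidPDE
open Summit.NavierStokesRegularity.NavierStokesRegularity.Theorems.PowerGaugeEulerLiouville.Kelvin
open Summit.NavierStokesRegularity.NavierStokesRegularity.Theorems.PowerGaugeEulerLiouville.BernoulliLandscape

variable {γ : ℝ} {U : EuclideanSpace ℝ (Fin 3) → EuclideanSpace ℝ (Fin 3)} {P : EuclideanSpace ℝ (Fin 3) → ℝ}

/-- **The Bernoulli function is non-increasing along FORWARD similarity orbits.**  `(U, P)` a `C²` profile of CIV (3.3) with `γ ≤ ½`; `Y` with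
`Y′(t) = W(Y(t))` on `[0, t₁]`.  Then `ℋ(Y t₁) ≤ ℋ(Y 0)`. [cite: ConstantinIgnatovaVicol2026Putative, §3.4.3 eq. (3.31)–(3.33)] -/
theorem selfSimilarBernoulli_antitone_forward (hprof : IsSelfSimilarEulerProfile γ 0 U P) (hγ2 : γ ≤ 1 / 2)
    {Y : ℝ → EuclideanSpace ℝ (Fin 3)} {t₁ : ℝ} (ht₁ : 0 ≤ t₁)
    (hY : ∀ t ∈ Icc 0 t₁, HasDerivAt Y (selfSimilarTransport γ 0 U (Y t)) t) :
    selfSimilarBernoulli γ 0 U P (Y t₁) ≤ selfSimilarBernoulli γ 0 U P (Y 0) := by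
  set Hb : EuclideanSpace ℝ (Fin 3) → ℝ := selfSimilarBernoulli γ 0 U P with hHb
  have hHd : Differentiable ℝ Hb := hprof.contDiff_selfSimilarBernoulli.differentiable (by norm_num)
  have hder : ∀ t ∈ Icc 0 t₁, HasDerivAt (fun s => Hb (Y s))
      ((2 * γ - 1) * ‖selfSimilarTransport γ 0 U (Y t)‖ ^ 2) t := by
    intro t ht
    have h1 := (hHd (Y t)).hasFDerivAt.comp_hasDerivAt t (hY t ht)
    rw [hprof.fderiv_selfSimilarBernoulli_transport (Y t)] at h1
    exact h1
  have hcont : ContinuousOn (fun s => Hb (Y s)) (Icc 0 t₁) :=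
    fun t ht => (hder t ht).continuousAt.continuousWithinAt
  have hanti : AntitoneOn (fun s => Hb (Y s)) (Icc 0 t₁) := by
    refine antitoneOn_of_hasDerivWithinAt_nonpos (convex_Icc 0 t₁) hcont
      (fun t ht => (hder t (interior_subset ht)).hasDerivWithinAt) ?_
    intro t _
    have hγ' : 2 * γ - 1 ≤ 0 := by linarith
    exact mul_nonpos_of_nonpos_of_nonneg hγ' (sq_nonneg _)
  exact hanti ⟨le_rfl, ht₁⟩ ⟨ht₁, le_rfl⟩ ht₁

/-- **MINIMUM PRINCIPLE FOR THE BERNOULLI FUNCTION: on every closed ball `ℋ` attains its minimum on the boundary sphere.**  `(U, P)` a `C²` profile of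
CIV (3.3) with `0 < γ ≤ ½`; then for every centre `z`, radius `δ > 0` and point `x` with `‖x − z‖ ≤ δ` there is `y` with `‖y − z‖ = δ` and `ℋ(y) ≤ ℋ(x)`.
(Otherwise `ball(z,δ) ∩ {ℋ < min_{sphere} ℋ}` is a bounded forward-invariant open set of positive measure, against the volume growth `e^{3γ}` of the
similarity flow, `BernoulliLandscape.volume_image_flow_eq_exp_of_stay`.) [folklore] -/
theorem exists_sphere_selfSimilarBernoulli_le (hprof : IsSelfSimilarEulerProfile γ 0 U P) (hγ : 0 < γ) (hγ2 : γ ≤ 1 / 2)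
    (z : EuclideanSpace ℝ (Fin 3)) {δ : ℝ} (hδ : 0 < δ) (x : EuclideanSpace ℝ (Fin 3)) (hx : ‖x - z‖ ≤ δ) :
    ∃ y : EuclideanSpace ℝ (Fin 3), ‖y - z‖ = δ ∧ selfSimilarBernoulli γ 0 U P y ≤ selfSimilarBernoulli γ 0 U P x := by
  set Hb : EuclideanSpace ℝ (Fin 3) → ℝ := selfSimilarBernoulli γ 0 U P with hHb
  have hU2 : ContDiff ℝ 2 U := hprof.contDiff_velocity
  have hHc : Continuous Hb := hprof.contDiff_selfSimilarBernoulli.continuous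
  by_contra hcon
  push Not at hcon
  -- `hcon : ∀ y, ‖y - z‖ = δ → Hb x < Hb y`; the point `x` is then in the OPEN ball
  have hxin : ‖x - z‖ < δ := by
    rcases hx.lt_or_eq with h | h
    · exact h
    · exact absurd (hcon x h) (lt_irrefl _)
  -- the minimum `m` of `ℋ` on the sphere, `> ℋ x`
  have hScpt : IsCompact (sphere z δ) := isCompact_sphere z δ
  have hSne : (sphere z δ).Nonempty := (NormedSpace.sphere_nonempty).2 hδ.le
  obtain ⟨y₀, hy₀, hmin⟩ := hScpt.exists_isMinOn hSne hHc.continuousOn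
  set m : ℝ := Hb y₀ with hm
  have hmS : ∀ y, ‖y - z‖ = δ → m ≤ Hb y := fun y hy => hmin (mem_sphere_iff_norm.2 hy)
  have hxm : Hb x < m := hcon y₀ (mem_sphere_iff_norm.1 hy₀)
  -- the cut-off field on `ball 0 (‖z‖ + δ + 1)` and its global flow
  set R : ℝ := ‖z‖ + δ with hR
  have hRpos : 0 < R + 1 := by have := norm_nonneg z; linarith
  obtain ⟨Vc, hVc, -, -, ⟨K, hK⟩, hagree⟩ := exists_cutoff_local_smul hU2 (R := R + 1) hRpos
  have hVc1 : ContDiff ℝ 1 Vc := hVc.of_le (by norm_num)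
  have hballR : ∀ w : EuclideanSpace ℝ (Fin 3), ‖w - z‖ ≤ δ → ‖w‖ ≤ R := by
    intro w hw
    have := norm_le_norm_add_norm_sub' w z
    rw [hR]; linarith
  have hnear : ∀ w : EuclideanSpace ℝ (Fin 3), ‖w‖ ≤ R → Vc =ᶠ[𝓝 w] U := by
    intro w hw
    have hmem : ball (0 : EuclideanSpace ℝ (Fin 3)) (R + 1) ∈ 𝓝 w :=
      isOpen_ball.mem_nhds (by rw [mem_ball, dist_zero_right]; linarith)
    exact Filter.eventually_of_mem hmem fun y hy => hagree y hy
  have hWeq : ∀ w : EuclideanSpace ℝ (Fin 3), ‖w‖ ≤ R → selfSimilarTransport γ 0 Vc w = selfSimilarTransport γ 0 U w := by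
    intro w hw
    simp only [selfSimilarTransport_apply, hagree w (by rw [mem_ball, dist_zero_right]; linarith)]
  have hdivc : ∀ w : EuclideanSpace ℝ (Fin 3), ‖w‖ ≤ R → VectorCalculus.divergence Vc w = 0 := by
    intro w hw
    have h1 : fderiv ℝ Vc w = fderiv ℝ U w := (hnear w hw).fderiv_eq
    have h2 := hprof.divFree w
    simp only [VectorCalculus.divergence] at h2 ⊢
    rw [h1]; exact h2
  set Φ := ODE.evolutionMap (fun _ : ℝ => selfSimilarTransport γ 0 Vc) 0 with hΦ
  have hflow : ∀ s w, HasDerivAt (fun r => Φ r w) (selfSimilarTransport γ 0 Vc (Φ s w)) s :=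
    fun s w => C2.Kelvin.hasDerivAt_flow (γ := γ) hVc1 hK s w
  -- the bounded open set `Uo = ball z δ ∩ {ℋ < m}`, forward-invariant
  set Uo : Set (EuclideanSpace ℝ (Fin 3)) := {w | ‖w - z‖ < δ ∧ Hb w < m} with hUo
  have hUo_open : IsOpen Uo :=
    (isOpen_lt (continuous_id.sub continuous_const).norm continuous_const).inter (isOpen_lt hHc continuous_const)
  have hxU : x ∈ Uo := ⟨hxin, hxm⟩
  -- forward invariance: an orbit from `Uo` stays in the open ball (and below `m`) for all `s ≥ 0`
  have hinv : ∀ w ∈ Uo, ∀ s, 0 ≤ s → ‖Φ s w - z‖ < δ ∧ Hb (Φ s w) < m := by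
    intro w hw s hs
    have hΦ0 : Φ 0 w = w := ODE.evolutionMap_self _ 0 w
    have hYc : Continuous fun r => Φ r w := continuous_iff_continuousAt.2 fun r => (hflow r w).continuousAt
    -- `ℋ` is non-increasing on any initial interval during which the orbit stays in the closed ball
    have hmono : ∀ t, 0 ≤ t → (∀ σ ∈ Icc 0 t, ‖Φ σ w - z‖ ≤ δ) → Hb (Φ t w) ≤ Hb w := by
      intro t ht hin
      have hYU : ∀ σ ∈ Icc 0 t, HasDerivAt (fun r => Φ r w) (selfSimilarTransport γ 0 U (Φ σ w)) σ := by
        intro σ hσ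
        have h := hflow σ w
        rwa [hWeq (Φ σ w) (hballR _ (hin σ hσ))] at h
      have h := selfSimilarBernoulli_antitone_forward hprof hγ2 ht hYU
      rwa [hΦ0] at h
    -- suppose the orbit reaches the sphere; take the first such time
    by_contra hbad
    have hexit : ∃ t, 0 ≤ t ∧ t ≤ s ∧ δ ≤ ‖Φ t w - z‖ := by
      by_contra hno
      push Not at hno
      have hin : ∀ σ ∈ Icc 0 s, ‖Φ σ w - z‖ ≤ δ := fun σ hσ => (hno σ hσ.1 hσ.2).le
      have h1 : ‖Φ s w - z‖ < δ := hno s hs le_rfl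
      have h2 : Hb (Φ s w) < m := lt_of_le_of_lt (hmono s hs hin) hw.2
      exact hbad ⟨h1, h2⟩
    set Tset : Set ℝ := {t | 0 ≤ t ∧ δ ≤ ‖Φ t w - z‖} with hTset
    obtain ⟨t₂, ht₂0, -, ht₂δ⟩ := hexit
    have hTne : Tset.Nonempty := ⟨t₂, ht₂0, ht₂δ⟩
    have hTcl : IsClosed Tset := by
      rw [hTset, setOf_and]
      exact (isClosed_le continuous_const continuous_id).inter
        (isClosed_le continuous_const (hYc.sub continuous_const).norm)
    have hTbdd : BddBelow Tset := ⟨0, fun t ht => ht.1⟩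
    set t₁ : ℝ := sInf Tset with ht₁
    have ht₁T : t₁ ∈ Tset := hTcl.csInf_mem hTne hTbdd
    have ht₁0 : 0 ≤ t₁ := ht₁T.1
    have hbefore : ∀ t, 0 ≤ t → t < t₁ → ‖Φ t w - z‖ < δ := by
      intro t ht0 htlt
      by_contra hge
      push Not at hge
      have : t₁ ≤ t := csInf_le hTbdd ⟨ht0, hge⟩
      linarith
    have ht₁pos : 0 < t₁ := by
      rcases ht₁0.lt_or_eq with h | h
      · exact h
      · exfalso
        have := ht₁T.2
        rw [← h, hΦ0] at this
        linarith [hw.1]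
    -- `‖Φ t₁ w − z‖ = δ`
    have hnorm₁ : ‖Φ t₁ w - z‖ = δ := by
      refine le_antisymm ?_ ht₁T.2
      by_contra hgt
      push Not at hgt
      have hev : ∀ᶠ t in 𝓝 t₁, δ < ‖Φ t w - z‖ :=
        ((hYc.sub continuous_const).norm.continuousAt (x := t₁)).eventually (lt_mem_nhds hgt)
      obtain ⟨ε, hε, hball⟩ := Metric.eventually_nhds_iff.1 hev
      set t : ℝ := max (t₁ - ε / 2) 0 with htdef
      have ht0 : 0 ≤ t := le_max_right _ _
      have htlt : t < t₁ := by rw [htdef]; exact max_lt (by linarith) ht₁pos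
      have hdist : dist t t₁ < ε := by
        rw [dist_comm, Real.dist_eq, abs_of_nonneg (by linarith)]
        have : t₁ - ε / 2 ≤ t := le_max_left _ _
        linarith
      have h1 := hball hdist
      have h2 := hbefore t ht0 htlt
      linarith
    have hin : ∀ σ ∈ Icc 0 t₁, ‖Φ σ w - z‖ ≤ δ := by
      intro σ hσ
      rcases hσ.2.lt_or_eq with h | h
      · exact (hbefore σ hσ.1 h).le
      · rw [h, hnorm₁]
    -- at the exit point `ℋ ≥ m`, but along the orbit `ℋ ≤ ℋ w < m`
    have h1 : m ≤ Hb (Φ t₁ w) := hmS _ hnorm₁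
    have h2 : Hb (Φ t₁ w) ≤ Hb w := hmono t₁ ht₁0 hin
    linarith [hw.2]
  -- volume bookkeeping: `Φ_1 Uo ⊆ Uo`, `vol(Φ_1 Uo) = e^{3γ} vol Uo`, `0 < vol Uo < ∞`
  have hsub : Φ 1 '' Uo ⊆ Uo := by
    rintro _ ⟨w, hw, rfl⟩
    exact hinv w hw 1 zero_le_one
  have hstay : ∀ w ∈ Uo, ∀ σ ∈ Icc (0 : ℝ) 1, ‖Φ σ w‖ ≤ R := fun w hw σ hσ =>
    hballR _ (hinv w hw σ hσ.1).1.le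
  have hvol := volume_image_flow_eq_exp_of_stay (γ := γ) hVc hK zero_le_one hdivc hUo_open.measurableSet hstay
  have hpos : 0 < volume Uo := hUo_open.measure_pos volume ⟨x, hxU⟩
  have hfin : volume Uo < ⊤ := by
    refine (measure_mono (fun w hw => ?_)).trans_lt (measure_ball_lt_top (μ := volume) (x := z) (r := δ))
    exact mem_ball_iff_norm.2 hw.1
  have hle : volume (Φ 1 '' Uo) ≤ volume Uo := measure_mono hsub
  rw [hvol] at hle
  have hgt : 1 < Real.exp (3 * γ * 1) := Real.one_lt_exp_iff.2 (by linarith)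
  have hreal := ENNReal.toReal_mono hfin.ne hle
  rw [ENNReal.toReal_mul, ENNReal.toReal_ofReal (Real.exp_pos _).le] at hreal
  have hv : 0 < (volume Uo).toReal := ENNReal.toReal_pos hpos.ne' hfin.ne
  nlinarith

/-- **The Bernoulli function of a `C²` in-window profile has NO STRICT LOCAL MINIMUM**: there is no `z` and `δ > 0` with `ℋ(z) < ℋ(y)` for all `y ≠ z` in
`‖y − z‖ ≤ δ`. [folklore] -/
theorem not_strictLocalMin_selfSimilarBernoulli (hprof : IsSelfSimilarEulerProfile γ 0 U P) (hγ : 0 < γ) (hγ2 : γ ≤ 1 / 2)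
    (z : EuclideanSpace ℝ (Fin 3)) {δ : ℝ} (hδ : 0 < δ) :
    ¬ ∀ y : EuclideanSpace ℝ (Fin 3), y ≠ z → ‖y - z‖ ≤ δ → selfSimilarBernoulli γ 0 U P z < selfSimilarBernoulli γ 0 U P y := by
  intro h
  obtain ⟨y, hy, hle⟩ := exists_sphere_selfSimilarBernoulli_le hprof hγ hγ2 z hδ z (by simpa using hδ.le)
  have hyz : y ≠ z := by
    intro hyz
    rw [hyz, sub_self, norm_zero] at hy
    exact hδ.ne' hy.symm
  exact absurd (h y hyz hy.le) (not_lt.2 hle)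

/-- **Closed-ball form of the minimum principle**: `min_{‖x−z‖≤δ} ℋ = min_{‖y−z‖=δ} ℋ` — for every `x` in the closed ball the sphere carries a point with
smaller or equal Bernoulli value; in particular `inf_{B̄(z,δ)} ℋ ≥ inf_{S(z,δ)} ℋ`. [folklore] -/
theorem iInf_sphere_selfSimilarBernoulli_le (hprof : IsSelfSimilarEulerProfile γ 0 U P) (hγ : 0 < γ) (hγ2 : γ ≤ 1 / 2)
    (z : EuclideanSpace ℝ (Fin 3)) {δ : ℝ} (hδ : 0 < δ) (x : EuclideanSpace ℝ (Fin 3)) (hx : ‖x - z‖ ≤ δ) :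
    ⨅ y : sphere z δ, selfSimilarBernoulli γ 0 U P y ≤ selfSimilarBernoulli γ 0 U P x := by
  obtain ⟨y, hy, hle⟩ := exists_sphere_selfSimilarBernoulli_le hprof hγ hγ2 z hδ x hx
  have hbdd : BddBelow (range fun y : sphere z δ => selfSimilarBernoulli γ 0 U P y) := by
    have hc : Continuous (selfSimilarBernoulli γ 0 U P) := hprof.contDiff_selfSimilarBernoulli.continuous
    obtain ⟨b, hb⟩ := (isCompact_sphere z δ).bddBelow_image hc.continuousOn
    exact ⟨b, by rintro _ ⟨w, rfl⟩; exact hb ⟨w, w.2, rfl⟩⟩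
  exact (ciInf_le hbdd ⟨y, mem_sphere_iff_norm.2 hy⟩).trans hle

end Summit.NavierStokesRegularity.NavierStokesRegularity.Theorems.PowerGaugeEulerLiouville.Loc
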